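import Summits.RiemannHypothesis.RiemannHypothesis.Theorems.WeilTwoPrimeDeflE25EBase
import Literature.NumberTheory.LFunctions.WeilBlockRows
import Literature.NumberTheory.LFunctions.WeilBlockRowsDCFast
import HarnessLib

/-!
# Even-sector deflated two-prime certificate E25E: rows 0–3 of the even check `D C = I`

`WeilCert.checkDCRow 0` for certificate E25E, row by row via the linear-traversal check `WeilCert.checkDCRowF` (`decide +kernel`) and `WeilCert.checkDCRow_of_F`. Pure proof file.
-/

set_option linter.dupNamespace false

noncomputable section

namespace Summit.RiemannHypothesis.RiemannHypothesis.Theorems.EvenWinsBeyondArch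

open Literature.NumberTheory.LFunctions

set_option maxHeartbeats 0 in
/-- Fast kernel check of row 0 of the even `D C = I` (certificate E25E; linear traversals). [folklore] -/
theorem checkDCRowF0_0_weilCertDeflE25E : weilCertDeflE25EBase.checkDCRowF 0 0 = true := by
  decide +kernel

/-- Row 0 of the even `D C = I` (certificate E25E), from the fast check. [folklore] -/
theorem checkDCRow0_0_weilCertDeflE25E : weilCertDeflE25EBase.checkDCRow 0 0 = true :=
  WeilCert.checkDCRow_of_F checkDCRowF0_0_weilCertDeflE25E

set_option maxHeartbeats 0 in
/-- Fast kernel check of row 1 of the even `D C = I` (certificate E25E; linear traversals). [folklore] -/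
theorem checkDCRowF0_1_weilCertDeflE25E : weilCertDeflE25EBase.checkDCRowF 0 1 = true := by
  decide +kernel

/-- Row 1 of the even `D C = I` (certificate E25E), from the fast check. [folklore] -/
theorem checkDCRow0_1_weilCertDeflE25E : weilCertDeflE25EBase.checkDCRow 0 1 = true :=
  WeilCert.checkDCRow_of_F checkDCRowF0_1_weilCertDeflE25E

set_option maxHeartbeats 0 in
/-- Fast kernel check of row 2 of the even `D C = I` (certificate E25E; linear traversals). [folklore] -/
theorem checkDCRowF0_2_weilCertDeflE25E : weilCertDeflE25EBase.checkDCRowF 0 2 = true := by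
  decide +kernel

/-- Row 2 of the even `D C = I` (certificate E25E), from the fast check. [folklore] -/
theorem checkDCRow0_2_weilCertDeflE25E : weilCertDeflE25EBase.checkDCRow 0 2 = true :=
  WeilCert.checkDCRow_of_F checkDCRowF0_2_weilCertDeflE25E

set_option maxHeartbeats 0 in
/-- Fast kernel check of row 3 of the even `D C = I` (certificate E25E; linear traversals). [folklore] -/
theorem checkDCRowF0_3_weilCertDeflE25E : weilCertDeflE25EBase.checkDCRowF 0 3 = true := by
  decide +kernel

/-- Row 3 of the even `D C = I` (certificate E25E), from the fast check. [folklore] -/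
theorem checkDCRow0_3_weilCertDeflE25E : weilCertDeflE25EBase.checkDCRow 0 3 = true :=
  WeilCert.checkDCRow_of_F checkDCRowF0_3_weilCertDeflE25E


end Summit.RiemannHypothesis.RiemannHypothesis.Theorems.EvenWinsBeyondArch
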